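import Summits.QuantumFields.YangMills.Theorems.BalabanUVNodesK0Stub1MultiplierO1LetterAtRecord
import HarnessLib

/-!
# K0⁷ STUB 1 (`stub_prop8StepCoP13`), sub-target S4b — **THE COMPOSITE LETTER `Qᵗ_V∘(η^d•M_V)` AT NODE 00's CARRIER**: for the STRAIGHT multi-level average `Q_V`
# (p598821's extension of lit-balaban's `QE`) the composite of its transpose `Qᵗ_V` (w.r.t. `BE = η^dΣ`, `B = Σ`) with the normalised multiplier `η^d•M_V` IS the kernel
# extension of `∂*∂∘H` (p612514 `QtV_smul_MV_eq_curlCurlHV`), and its letter — `w₃(b)·‖Qᵗ_V((η^d•M_V)X)(b)‖ ≤ q₁·s` for `‖X_t‖ ≤ s`, EVERY fine bond `b`, every level — is the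
# text's `∂*∂`-row of `H` ([15] (161)₃) against a PLAIN row sum over the index bonds (Lemma 2.1 on the torus), with ONE constant `q₁` depending on `L` only

Cell `pub-ymgap`, width seat `pub-ymgap-k0-s1-w4` g0′ (FILE 5; HOME `pub-ymgap-k0-s1-w4/HANDOFF.md` trigger (t1) = the DESIGN NOTE of 2026-08-28 07:34Z, and reading (R1) of
`pub-ymgap-k0-s1-w4/LOCATED-Q0-COMB.md`).  `--kind proof --supports stmt-QuantumFields-20541 --as helper`; count-neutral.  [15] = [Balaban1985Variational]; [B6] =
[Balaban1984PropagatorsII].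

WHY.  The S4b capstone (p612123) displays the multiplier term's estimate as a product `q₀·O₁` of two letters (`O₁` for `M`, `q₀` for `Qᵗ`); FILE 4 supplies `O₁` for
`η^d•M_V`.  For the average of record in the multiplier term two readings exist (LOCATED-Q0-COMB): with the EML linearisation `Qlin` the transpose carries the coarse comb
`η^{1−d}Λᵀ∘div` and no k-uniform `q₀` exists; with print's straight `LʲηQ_j` ((45) p. 285; the tree's `Q_V`) the composite `Qᵗ_V∘(η^d•M_V) = (∂*∂H)_V` is an IDENTITY
(p612514) and its letter is a ROW of `H`: `w₃(b)|∂*∂(He_c)(b)| ≤ C₃e^{−r·d(b,c)}` (k0-s1-w3's port `K0FlatPortHRows34P.hRow3_of_portShapes`, from [B6] Prop. 2.7 + Lemma 2.1)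
summed over `c` with NO datum weight (`Σ_c e^{−r(d_T(y(b),βc)+3)} ≤ 2D·K₂.₆₁`, Lemma 2.1 (2.61) at the block of `b` + the fibre count `B6Cor28KLevelV1L0.sum_comp_beta_le`)
— for the T³ carrier this is the ym3-torus cell's (X1) `UnitScaleTiltProp8FlatPortCurlCurlSupRowL0` (w3 g4); THIS FILE is its d-generic twin at the record's four-tori,
packaged in the S4b capstone's currency together with p612514's identity.

WHAT IS PROVED (sorry-free; no definition; axioms standard).
* §1 ★★ `curlCurlRowSum_domT` (the d-generic twin of the ym3-torus cell's `FlatPortCurlCurlSupRowL0.curlCurlSupRow_domT`, stated as the kernel row sum) — at every charted family `domT hN D hk` of `PV d ℓ m K` (any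
  `d`, odd `L ≥ 5`): `Mh₀, R₀` and `q₁ ≥ 0` (functions of `d, L`) with `w 3 b·Σ_c |(∂*∂ flatH e_c)(b)| ≤ q₁` for every (152) weight family `w` and EVERY fine bond `b`
  (`flatH` = canonical `GQ*(QGQ*)⁻¹`, units `L^{K−n}`, `∂*∂ = dcsE∘dcE`).
* §2 ★★ `curlCurlRowSum_of_adm22` (every `Adm22 D R (L·M_h)` family, level-0 chart) · §3 `curlCurlRowSum_of_adm22_T4` (the record's tori) · `curlCurl_kernel_eq_flatH`
  (p612514's `K_V` kernel = `flatH`'s, any auxiliary weights) · ★★★ `compositeQtM_letter_of_adm22_T4` — for every `F : T4Family`: `Mh₀, R₀, q₁` such that at every admissible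
  family in the standing range, every normed `ℂ`-space fibre `𝔸`, every `M_V`, `Qᵗ_V` with p598821's kernel formulas (units `c = L^{K−n}`, ANY auxiliary weights) and every block
  datum with `‖X_t‖ ≤ s`, `0 ≤ s`: `w 3 b·‖Qᵗ_V(((η:ℂ)^d•M_V) X)(b)‖ ≤ q₁·s` at EVERY fine bond `b` — the capstone's `hQt'∘h3132` composite for the straight average, input weight `1`,
  k-uniform, no `wB′`.
HONEST SCOPE.  Bookkeeping over k0-s1-w3's port rows and lit-balaban's hypothesis-free [B6] chain; the letter concerns the STRAIGHT average's transpose `Qᵗ_V`, NOT the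
transpose of `Qlin` (for which see LOCATED-Q0-COMB); which average the capstone's multiplier term finally carries is the S2∕S4 lanes' decision ((87)∕(128) junction);
nothing of Bałaban's analysis asserted beyond the cited kernel theorems; `stub_prop8StepCoP13` ∕ K0⁷ NOT closed; N07 NOT discharged; counts unmoved (28∕28 · 5∕27); R4
closes the conditional finite-𝕋⁴ rung `BalabanLadder.UV` only, never the summit; the YM mass gap (Clay) is NOT proved by any of this; nothing continuum ∕ ℝ⁴ ∕ OS.
No `sorry`, no `def`, no `instance`, no `notation`.
References: [15] (27) p.282, (45) p.285, (66) p.287, (87)–(88) p.291, (139)–(140) p.299, (161)–(162) p.303; [B6] (2.35) p.228, Lemma 2.1 (2.59)–(2.63) pp.233–234, Prop. 2.7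
(2.149) p.249, Cor. 2.8 (2.150)–(2.151) p.249; [Balaban1987RG1] (0.1) p.251.
-/

set_option autoImplicit false

noncomputable section

open scoped BigOperators InnerProductSpace

namespace Summit.QuantumFields.YangMills.Theorems.K0Stub1CompositeQtMLetterAtRecord

open K0FlatPortBudgetsP (theta_budget absorb_budget chart_params)
open K0FlatPortKernelRowsP (unitWeights_pos globalBand_unitWeights)
open K0FlatPortHRows34P (hRow3_of_portShapes toLp_flatH_eq_hOp)
open Literature.MathematicalPhysics.QuantumFieldTheory.Balaban1983to89
open Literature.MathematicalPhysics.QuantumFieldTheory.Balaban1983to89.T4Continuum (T4Family)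
open Literature.MathematicalPhysics.QuantumFieldTheory.BalabanImbrieJaffe1984to88.BIJ85AxialPropagator411 (BondSpace)
open B6MultiLevelBoxOperator (N0)
open B6MultiLevelTorusOperatorL0 (TDomains)
open B6Geom246MultiLevelBoxL0 (bset)
open B6Geom246MultiLevelTorusL0 (geomT bondT lemma21_torus)
open B6GlobalChartV1 (PV)
open B6GlobalChartV1L0 (domT blkV1)
open B6Ineq2142KLevelV1L0 (β)
open B6RandomWalk (delta3 delta3_pos)
open B6Ineq261LevelGap (K261 K261_nonneg)
open B6Ineq281MultiLevelBox (Kprof)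
open B6SectADomainsV1 (Domains)
open B6SectAOperatorsV1 (BondIdx BondIdxSpace QE QsE aE dcE dcsE)
open B6SectAVectorModelV1 (GE EE)
open B6SectA (hOp)
open B6Cor28KLevelV1L0 (sum_comp_beta_le)
open B6Prop23MultiLevelTorusL0 (sumBound_torus)
open B6QGQCoerciveKLevelV1 (gam0 gam0_pos)
open FlatPortHRows12 (cf_ne_zero)
open FlatPortProp27PadL0 (prop27_kLevel_pad)
open Summit.QuantumFields.YangMills.Theorems.FlatCubeOpsText (Adm22)
open Summit.QuantumFields.YangMills.Theorems.FlatCubeOperators (hOp_eq_hOp)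
open Summit.QuantumFields.YangMills.Theorems.FlatScalarExtension (apply_eq_sum_kernel)
open Summit.QuantumFields.YangMills.Theorems.K0FlatCubeOpsTextP (IsLevWeight flatH)
open Summit.QuantumFields.YangMills.Theorems.K0Stub1MultiplierNormalisation (QtV_smul_MV_eq_curlCurlHV)
open Summit.QuantumFields.YangMills.Theorems.K0Stub1MultiplierO1LetterAtRecord (norm_kernel_smul_sum_le)

/-! ## §1  ★★ The curl-curl row of the canonical `H` against a plain row sum, at every charted family -/



/-- ★★ **THE CURL-CURL ROW OF THE CANONICAL `H` AGAINST A PLAIN ROW SUM, AT A CHARTED FAMILY**: for odd `L = ℓ + 1 ≥ 5` and any dimension `d + 1` there are `Mh₀, R₀` and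
`q₁ ≥ 0` (functions of `d, L`) such that in the standing range (`1 ≤ K − n`, `K − n + 1 ≤ m + K`, `M_h = Lᵃ ≥ Mh₀`, `R ≥ R₀`, `P′ = L·P″`, `P″ ≥ 5`), for every (152) weight
family `w` and EVERY fine bond `b`: `w 3 b·Σ_c |(∂*∂(flatH e_c))(b)| ≤ q₁` — the port's row (161)₃ `w₃|∂*∂He_c(b)| ≤ C₃e^{−r(d_T(y(b),βc)+3)}` (`hRow3_of_portShapes`: [B6]
Prop. 2.7 (2.149) at the unit band, Lemma 2.1 (2.63) at rate `δ₄∕2`, the absorption threshold) summed with Lemma 2.1 (2.61) at the block `y(b)` and the fibre count `2D`;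
`q₁ = C₃·2D·K₂.₆₁`. [cite: Balaban1985Variational, (161)-(162) p.303, (139)-(140) p.299; Balaban1984PropagatorsII, Prop. 2.7 (2.149) p.249, Cor. 2.8 (2.151) p.249, Lemma 2.1 (2.59)-(2.63) pp.233-234] -/
theorem curlCurlRowSum_domT (d ℓ : ℕ) (hd : 1 ≤ d + 1) (hL : Odd (ℓ + 1) ∧ 1 < ℓ + 1) (hℓ : 4 ≤ ℓ) :
    ∃ (Mh₀ R₀ : ℕ) (q₁ : ℝ), 0 ≤ q₁ ∧
    ∀ (m : ℕ) (n K : ℕ) {Mh R : ℕ} {P' : Fin (d + 1) → ℕ} (hN : ∀ μ, N0 ℓ Mh (K - n) P' μ = (PV d ℓ m K hd hL).sitesPerDir 0)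
      (D : TDomains d ℓ Mh (K - n) P' R) (hk : K - n ≤ m + K) (_ : 1 ≤ K - n) (_ : K - n + 1 ≤ m + K)
      {P'' : Fin (d + 1) → ℕ} (_ : ∀ μ, P' μ = (ℓ + 1) * P'' μ) (_ : ∀ μ, 5 ≤ P'' μ)
      {a : ℕ} (_ : Mh = (ℓ + 1) ^ a) (_ : Mh₀ ≤ Mh) (_ : R₀ ≤ R)
      (w : ℕ → PBond (PV d ℓ m K hd hL) 0 → ℝ) (_ : IsLevWeight (PV d ℓ m K hd hL) (K - n) (domT hN D hk) w)
      (b : PBond (PV d ℓ m K hd hL) 0),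
      w 3 b * ∑ c : BondIdx (domT hN D hk), |(dcsE ((((ℓ + 1 : ℕ) : ℝ)) ^ (K - n)) (dcE ((((ℓ + 1 : ℕ) : ℝ)) ^ (K - n))
        (WithLp.toLp 2 (flatH (PV d ℓ m K hd hL) (K - n) (domT hN D hk) (Pi.single c 1))))) b| ≤ q₁ := by
  classical
  -- [B6] Prop. 2.7 (2.149) at the unit band (port pad); its rate `δ₄`
  obtain ⟨σb, hσb, hB⟩ := prop27_kLevel_pad d ℓ hd hL one_pos (le_refl (1 : ℝ))
  obtain ⟨A', M₂b, cc, N₁b, hA', hM₂b, hcc, hrowsB⟩ := hB σb hσb le_rfl (1 / 2) (by norm_num) (by norm_num)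
  set δ₃ : ℝ := delta3 (1 / 2) (2 * σb) with hδ₃
  have hδ₃0 : 0 < δ₃ := delta3_pos (by norm_num) (by linarith)
  set γ₀ : ℝ := gam0 d ℓ 1 with hγ₀
  have hγ₀0 : 0 < γ₀ := gam0_pos d ℓ zero_le_one
  have hCγ0 : (0 : ℝ) ≤ 2 / γ₀ := div_nonneg zero_le_two hγ₀0.le
  set δ₄ : ℝ := min (δ₃ / 4) (γ₀ / A' / (2 * (1 * (4 / δ₃) * (2 * ((d : ℝ) + 1) * cc)) + 1)) with hδ₄
  have hδ₄0 : 0 < δ₄ := lt_min (by linarith) (div_pos (div_pos hγ₀0 hA') (by positivity))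
  have hδ₄3 : δ₄ ≤ δ₃ := (min_le_left _ _).trans (by linarith)
  set r : ℝ := (1 - 1 / 16) * (δ₄ / 2) with hr
  have hr0 : 0 < r := by rw [hr]; positivity
  -- Lemma-2.1 budgets: (2.63) at rate `δ₄/2`, `α = 1/16` (the row); (2.61) at `(16r, 1/16)` (the plain row sum); absorption at `δ₄`
  obtain ⟨hN63pos, hθ63⟩ := theta_budget d ℓ (show 0 < 1 / 16 * (δ₄ / 2) by positivity)
  obtain ⟨hNrpos, hθr⟩ := theta_budget d ℓ (show 0 < 1 / 16 * (16 * r) by positivity)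
  set N63 : ℕ := ⌈2 * ((d + 1 : ℕ) : ℝ) * Real.log ((ℓ : ℝ) + 1) / (1 / 16 * (δ₄ / 2))⌉₊ + 1 with hN63
  set Nr : ℕ := ⌈2 * ((d + 1 : ℕ) : ℝ) * Real.log ((ℓ : ℝ) + 1) / (1 / 16 * (16 * r))⌉₊ + 1 with hNr
  set Na4 : ℕ := ⌈2 * ((d : ℝ) + 3) * ((ℓ : ℝ) + 1) / δ₄⌉₊ with hNa4
  set Lr : ℝ := (ℓ : ℝ) + 1 with hLr
  have hL1 : (1 : ℝ) ≤ Lr := by rw [hLr]; linarith [(Nat.cast_nonneg ℓ : (0 : ℝ) ≤ ℓ)]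
  set c63 : ℝ := K261 N63 (d + 1) Lr 1 (1 / 16 * (δ₄ / 2)) with hc63
  set c261 : ℝ := K261 Nr (d + 1) Lr 1 (1 / 16 * (16 * r)) with hc261
  have hc261_0 : 0 ≤ c261 := K261_nonneg (by linarith : (0 : ℝ) ≤ Lr) zero_le_one
  -- the row constant of `hRow3_of_portShapes` and the letter constant
  set C₃ : ℝ := (2 / γ₀ * (2 * (((ℓ + 1 : ℕ) : ℝ)) ^ (d + 1) * Real.exp (δ₃ * ((ℓ : ℝ) + 3))) * ((ℓ : ℝ) + 1) ^ 2 * ((ℓ : ℝ) + 1) ^ (d + 3) * (2 * ((d : ℝ) + 1)) *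
      c63 ^ 2) * Real.exp (3 * ((1 - 1 / 16) * (δ₄ / 2))) + 1 * Real.exp ((1 - 1 / 16) * (δ₄ / 2) * ((ℓ : ℝ) + 6)) with hC₃
  have hC₃0 : 0 ≤ C₃ := by
    have := K261_nonneg (N := N63) (dd := d + 1) (σ := 1 / 16 * (δ₄ / 2)) (by linarith : (0 : ℝ) ≤ Lr) zero_le_one
    rw [hC₃]; positivity
  set Mh₀ : ℕ := max 8 ⌈M₂b⌉₊ with hMh₀
  set R₀ : ℕ := max (2 * (ℓ + 1) ^ 2) (max (N₁b + 1) (max (N63 + 1) (max (Nr + 1) (Na4 + 1)))) with hR₀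
  refine ⟨Mh₀, R₀, C₃ * (2 * ((d : ℝ) + 1) * c261), by positivity, ?_⟩
  intro m n K Mh R P' hN D hk hk1 hk' P'' hLP hP5 a hMha hMh hR w hw b
  -- unpack the thresholds
  have hM8 : 8 ≤ Mh := le_trans (le_max_left _ _) hMh
  have hMh1 : 1 ≤ Mh := le_trans (by norm_num) hM8
  have hR2 : 2 * (ℓ + 1) ^ 2 ≤ R := le_trans (le_max_left _ _) hR
  have hRMh : 2 ≤ R * Mh := B6Cor28KLevelV1.two_le_RMh hR2 hM8
  have hRLM : ∀ {N₁ : ℕ}, N₁ + 1 ≤ R₀ → N₁ + 1 ≤ R * ((ℓ + 1) * Mh) := fun {N₁} h =>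
    le_trans (le_trans h hR) (Nat.le_mul_of_pos_right R (Nat.mul_pos (Nat.succ_pos ℓ) (by omega)))
  have hN₁b' : N₁b + 1 ≤ R * ((ℓ + 1) * Mh) := hRLM (le_trans (le_trans (le_max_left _ _) (le_max_right _ _)) le_rfl)
  have hN63' : N63 + 1 ≤ R * ((ℓ + 1) * Mh) := hRLM (le_trans (le_trans (le_trans (le_max_left _ _) (le_max_right _ _)) (le_max_right _ _)) le_rfl)
  have hNr' : Nr + 1 ≤ R * ((ℓ + 1) * Mh) :=
    hRLM (le_trans (le_trans (le_trans (le_trans (le_max_left _ _) (le_max_right _ _)) (le_max_right _ _)) (le_max_right _ _)) le_rfl)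
  have hNa4' : Na4 + 1 ≤ R * ((ℓ + 1) * Mh) :=
    hRLM (le_trans (le_trans (le_trans (le_trans (le_max_right _ _) (le_max_right _ _)) (le_max_right _ _)) (le_max_right _ _)) le_rfl)
  have hM₂b' : M₂b ≤ ((ℓ : ℝ) + 1) * Mh := by
    have h2 : (⌈M₂b⌉₊ : ℝ) ≤ (Mh : ℝ) := by exact_mod_cast le_trans (le_max_right _ _) hMh
    linarith [Nat.le_ceil M₂b, le_mul_of_one_le_left (Nat.cast_nonneg _ : (0 : ℝ) ≤ Mh) hL1]
  have hP1 : ∀ μ, 1 ≤ P' μ := fun μ => by rw [hLP μ]; exact Nat.mul_pos (Nat.succ_pos ℓ) (by have := hP5 μ; omega)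
  -- the port's band weights; (2.149); (2.63); absorption
  set ws : BondIdx (domT hN D hk) → ℝ := fun i =>
    ((((ℓ + 1 : ℕ) : ℝ)) ^ (K - n) / (((ℓ + 1 : ℕ) : ℝ)) ^ (i.1.1 : ℕ)) ^ 2 * ((((ℓ + 1 : ℕ) : ℝ)) ^ (i.1.1 : ℕ)) ^ (d + 1) with hws_def
  have hws : ∀ i, 0 < ws i := unitWeights_pos d ℓ hd hL m n K hN D hk
  have hband := globalBand_unitWeights d ℓ hd hL m n K hN D hk
  have h2149 := hrowsB m K hN D hk hk1 hk' hLP hP5 hMha hM8 hR2 hℓ hM₂b' hN₁b' (cf_ne_zero ℓ n K) hws hband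
  obtain ⟨-, -, -, h263⟩ := lemma21_torus (D := D) hMh1 hP1 hN63pos hN63' (div_nonneg hδ₄0.le zero_le_two)
    (by norm_num : (0 : ℝ) ≤ 1 / 16) (by norm_num : (1 : ℝ) / 16 ≤ 1) hθ63
  obtain ⟨hsm4, -, -⟩ := absorb_budget d ℓ hδ₄0 hNa4'
  -- the row (161)₃ per unit datum
  have hrow3 : ∀ c : BondIdx (domT hN D hk), w 3 b * |(dcsE ((((ℓ + 1 : ℕ) : ℝ)) ^ (K - n)) (dcE ((((ℓ + 1 : ℕ) : ℝ)) ^ (K - n))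
      (WithLp.toLp 2 (flatH (PV d ℓ m K hd hL) (K - n) (domT hN D hk) (Pi.single c 1))))) b| ≤
      C₃ * Real.exp (-(r * (((bondT D).dist (blkV1 hN D b) (β hN D hk c) : ℝ) + 3))) := fun c =>
    hRow3_of_portShapes d ℓ hd hL m n K hN D hk hRMh hMh1 hP1 hws zero_le_one hband hCγ0 hδ₄0 hδ₄3 (by norm_num : (1 : ℝ) / 16 ≤ 1) h2149 hsm4 h263 w hw
      c (Pi.single c 1) (Pi.single_eq_same c 1) (fun c' hc' => Pi.single_eq_of_ne hc' 1) b
  -- Lemma 2.1 (2.61) at the block of `b`, rate `r`; the fibre count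
  obtain ⟨-, h261, -, -⟩ := lemma21_torus (D := D) hMh1 hP1 hNrpos hNr' (δ₀ := 16 * r) (α := 1 / 16) (by positivity)
    (by norm_num) (by norm_num) hθr
  have hblocks : ∑ y', Real.exp (-(r * (geomT D).dist (blkV1 hN D b) y')) ≤ c261 := by
    have h := sumBound_torus (D := D) hMh1 hP1 h261 r hr0 (blkV1 hN D b)
    rwa [show Kprof (16 * r) c261 (Fintype.card ↥(bset D.toDomains)) r = c261 by unfold Kprof; rw [if_pos (by linarith)]] at h
  have hrowsum : ∑ c : BondIdx (domT hN D hk), Real.exp (-(r * (((bondT D).dist (blkV1 hN D b) (β hN D hk c) : ℝ) + 3))) ≤ 2 * ((d : ℝ) + 1) * c261 := by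
    have h1 := sum_comp_beta_le hN D hk (g := fun y' => Real.exp (-(r * (geomT D).dist (blkV1 hN D b) y'))) (fun _ => (Real.exp_pos _).le)
    have h3 : ∀ c : BondIdx (domT hN D hk), Real.exp (-(r * (((bondT D).dist (blkV1 hN D b) (β hN D hk c) : ℝ) + 3))) ≤
        Real.exp (-(r * (geomT D).dist (blkV1 hN D b) (β hN D hk c))) := fun c => by
      rw [Real.exp_le_exp]
      show -(r * (((bondT D).dist (blkV1 hN D b) (β hN D hk c) : ℝ) + 3)) ≤ -(r * ((bondT D).dist (blkV1 hN D b) (β hN D hk c) : ℝ))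
      nlinarith
    exact (Finset.sum_le_sum fun c _ => h3 c).trans (h1.trans (mul_le_mul_of_nonneg_left hblocks (by positivity)))
  -- assemble
  have hw3 : 0 ≤ w 3 b := by rw [hw 3 b]; positivity
  calc w 3 b * ∑ c : BondIdx (domT hN D hk), |(dcsE ((((ℓ + 1 : ℕ) : ℝ)) ^ (K - n)) (dcE ((((ℓ + 1 : ℕ) : ℝ)) ^ (K - n))
          (WithLp.toLp 2 (flatH (PV d ℓ m K hd hL) (K - n) (domT hN D hk) (Pi.single c 1))))) b|
      = ∑ c : BondIdx (domT hN D hk), w 3 b * |(dcsE ((((ℓ + 1 : ℕ) : ℝ)) ^ (K - n)) (dcE ((((ℓ + 1 : ℕ) : ℝ)) ^ (K - n))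
          (WithLp.toLp 2 (flatH (PV d ℓ m K hd hL) (K - n) (domT hN D hk) (Pi.single c 1))))) b| := Finset.mul_sum _ _ _
    _ ≤ ∑ c : BondIdx (domT hN D hk), C₃ * Real.exp (-(r * (((bondT D).dist (blkV1 hN D b) (β hN D hk c) : ℝ) + 3))) := Finset.sum_le_sum fun c _ => hrow3 c
    _ = C₃ * ∑ c : BondIdx (domT hN D hk), Real.exp (-(r * (((bondT D).dist (blkV1 hN D b) (β hN D hk c) : ℝ) + 3))) := by rw [Finset.mul_sum]
    _ ≤ C₃ * (2 * ((d : ℝ) + 1) * c261) := mul_le_mul_of_nonneg_left hrowsum hC₃0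

/-! ## §2  ★★ Every `Adm22` family of the P2 text (level-0 chart) -/

/-- ★★ **THE CURL-CURL ROW AGAINST A PLAIN ROW SUM AT EVERY ADMISSIBLE FAMILY** (level-0 chart `FlatPortChartL0.tdOfAdmL0` ∕ `domT_tdOfAdmL0`): for odd `L = ℓ + 1 ≥ 5`
there are `Mh₀, R₀`, `q₁ ≥ 0` such that for `1 ≤ K − n`, `K − n + 1 ≤ m + K`, `M = L·M_h`, `M_h = L^{a′} ≥ Mh₀`, `R ≥ R₀`, `a′ + 3 ≤ m + n`, every `D : Domains (PV d ℓ m K)`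
with `D.k = K − n`, `Adm22 D R (L·M_h)`, every (152) weight family and every fine bond `b`: `w 3 b·Σ_c |(∂*∂(flatH e_c))(b)| ≤ q₁`.
[cite: Balaban1985Variational, (161)-(162) p.303; Balaban1984PropagatorsII, (2.1)-(2.2) p.224, Cor. 2.8 (2.151) p.249, Lemma 2.1 (2.61) p.234] -/
theorem curlCurlRowSum_of_adm22 (d ℓ : ℕ) (hd : 1 ≤ d + 1) (hL : Odd (ℓ + 1) ∧ 1 < ℓ + 1) (hℓ : 4 ≤ ℓ) :
    ∃ (Mh₀ R₀ : ℕ) (q₁ : ℝ), 0 ≤ q₁ ∧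
    ∀ (m : ℕ) (n K : ℕ) (_ : 1 ≤ K - n) (_ : K - n + 1 ≤ m + K) {Mh R a' : ℕ} (_ : Mh = (ℓ + 1) ^ a') (_ : Mh₀ ≤ Mh) (_ : R₀ ≤ R)
      (_ : a' + 3 ≤ m + n) (D : Domains (PV d ℓ m K hd hL)) (hDk : D.k = K - n) (_ : Adm22 D R ((ℓ + 1) * Mh))
      (w : ℕ → PBond (PV d ℓ m K hd hL) 0 → ℝ) (_ : IsLevWeight (PV d ℓ m K hd hL) (K - n) D w)
      (b : PBond (PV d ℓ m K hd hL) 0),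
      w 3 b * ∑ c : BondIdx D, |(dcsE ((((ℓ + 1 : ℕ) : ℝ)) ^ (K - n)) (dcE ((((ℓ + 1 : ℕ) : ℝ)) ^ (K - n))
        (WithLp.toLp 2 (flatH (PV d ℓ m K hd hL) (K - n) D (Pi.single c 1))))) b| ≤ q₁ := by
  obtain ⟨Mh₀, R₀, q₁, hq₁, hmain⟩ := curlCurlRowSum_domT d ℓ hd hL hℓ
  refine ⟨Mh₀, R₀, q₁, hq₁, ?_⟩
  intro m n K hk1 hk' Mh R a' hMha hMh hR hsize D hDk hAdm
  have hk : K - n ≤ m + K := by omega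
  obtain ⟨hN, hLP, hP5⟩ := chart_params d ℓ m n K a' hd hL hℓ hk1 hsize
  rw [hMha] at hAdm
  have hN' : ∀ μ : Fin (d + 1), N0 ℓ Mh (K - n) (fun _ => 2 * (ℓ + 1) ^ (m + n - 1 - a')) μ = (PV d ℓ m K hd hL).sitesPerDir 0 := by
    rw [hMha]; exact hN
  rw [← hMha] at hAdm
  set D' := FlatPortChartL0.tdOfAdmL0 hN' D hDk hk hAdm with hD'
  have hEq : domT hN' D' hk = D := FlatPortChartL0.domT_tdOfAdmL0 hN' D hDk hk hAdm
  rw [← hEq]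
  exact hmain m n K hN' D' hk hk1 hk' hLP hP5 hMha hMh hR

/-! ## §3  NODE 00's four-tori and the capstone's currency -/

/-- **THE CURL-CURL ROW AGAINST A PLAIN ROW SUM ON THE RECORD's TORI** (`T4Family.P K = PV 3 ℓ m K` by `rfl`; units `c = L^{K−n}`).
[cite: Balaban1985Variational, (161)-(162) p.303; Balaban1984PropagatorsII, Cor. 2.8 (2.151) p.249; Balaban1987RG1, (0.1) p.251] -/
theorem curlCurlRowSum_of_adm22_T4 (F : T4Family) :
    ∃ (Mh₀ R₀ : ℕ) (q₁ : ℝ), 0 ≤ q₁ ∧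
    ∀ (n K : ℕ) (_ : 1 ≤ K - n) (_ : K - n + 1 ≤ F.m + K) {Mh R a' : ℕ} (_ : Mh = F.L ^ a') (_ : Mh₀ ≤ Mh) (_ : R₀ ≤ R)
      (_ : a' + 3 ≤ F.m + n) (D : Domains (F.P K)) (hDk : D.k = K - n) (_ : Adm22 D R (F.L * Mh))
      (w : ℕ → PBond (F.P K) 0 → ℝ) (_ : IsLevWeight (F.P K) (K - n) D w) (b : PBond (F.P K) 0),
      w 3 b * ∑ c : BondIdx D, |(dcsE (((F.P K).L : ℝ) ^ (K - n)) (dcE (((F.P K).L : ℝ) ^ (K - n))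
        (WithLp.toLp 2 (flatH (F.P K) (K - n) D (Pi.single c 1))))) b| ≤ q₁ := by
  obtain ⟨L, hL, h11, m, hm⟩ := F
  obtain ⟨ℓ, rfl⟩ : ∃ ℓ, L = ℓ + 1 := ⟨L - 1, by omega⟩
  have hℓ : 4 ≤ ℓ := by omega
  obtain ⟨Mh₀, R₀, q₁, hq₁, hmain⟩ := curlCurlRowSum_of_adm22 3 ℓ K0FlatCubeOpsTextP.hd4 hL hℓ
  exact ⟨Mh₀, R₀, q₁, hq₁, fun n K hk1 hk' Mh R a' hMha hMh hR hsize D hDk hAdm w hw b => hmain m n K hk1 hk' hMha hMh hR hsize D hDk hAdm w hw b⟩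

/-- **p612514's `K_V` KERNEL IS `flatH`'s** (any auxiliary weights `w > 0`, units `c = Lᵏ`; `H` is canonical — UST `FlatCubeOperators.hOp_eq_hOp`):
`(∂*∂(H e_s))(b)` read in `WithLp` equals `(∂*∂ (toLp (flatH e_s)))(b)`. [cite: Balaban1984PropagatorsII, (2.35) p.228; Balaban1985Variational, (157) p.302] -/
theorem curlCurl_kernel_eq_flatH {P : Params} {k : ℕ} (D : Domains P) (hc : ((P.L : ℝ) ^ k) ≠ 0) {w : BondIdx D → ℝ} (hw : ∀ i, 0 < w i)
    (s : BondIdx D) (b : PBond P 0) :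
    WithLp.ofLp (dcsE ((P.L : ℝ) ^ k) (dcE ((P.L : ℝ) ^ k) (hOp (GE D hc hw) (QsE D) (EE D hc hw) (WithLp.toLp 2 (Pi.single s 1))))) b =
      (dcsE ((P.L : ℝ) ^ k) (dcE ((P.L : ℝ) ^ k) (WithLp.toLp 2 (flatH P k D (Pi.single s 1))))) b := by
  have h1 : WithLp.toLp 2 (flatH P k D (Pi.single s 1)) =
      hOp (GE D hc (fun _ => one_pos) (w := fun _ => (1 : ℝ))) (QsE D) (EE D hc (fun _ => one_pos) (w := fun _ => (1 : ℝ))) (WithLp.toLp 2 (Pi.single s 1)) := rfl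
  rw [h1, hOp_eq_hOp D hc hw (fun _ => one_pos)]

/-- ★★★ **THE COMPOSITE LETTER `Qᵗ_V∘(η^d•M_V)` AT THE RECORD, EVERY FINE BOND, INPUT WEIGHT `1`** — for every `F : T4Family` there are `Mh₀, R₀` and ONE constant `q₁ ≥ 0`
such that at every admissible family of the record's tori in the standing range (`1 ≤ K − n`, `K − n + 1 ≤ m + K`, `M_h = L^{a′} ≥ Mh₀`, `R ≥ R₀`, `a′ + 3 ≤ m + n`,
`Adm22 D R (L·M_h)`, `D.k = K − n`, (152) weights `w`), for units `c = L^{K−n}` and ANY auxiliary weights `a > 0`, every normed `ℂ`-algebra fibre `𝔸` (e.g. `M_N(ℂ)`), every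
`M_V`, `Qᵗ_V` with p598821's kernel formulas (`exists_pairings_transposes_flatOps`) and every block datum with `‖X_t‖ ≤ s` (`0 ≤ s`):
`w 3 b·‖Qᵗ_V(((η:ℂ)^d•M_V) X)(b)‖ ≤ q₁·s`, `η = (L⁻¹)^{K−n}`, `d = (F.P K).d` — by p612514 `QtV_smul_MV_eq_curlCurlHV` the composite IS `(∂*∂H)_V X`, whose letter is §3's row.
[cite: Balaban1985Variational, (87)-(88) p.291, (27) p.282, (66) p.287, (161)-(162) p.303; Balaban1984PropagatorsII, (2.35) p.228, Cor. 2.8 (2.151) p.249, Lemma 2.1 (2.61) p.234; Balaban1987RG1, (0.1) p.251] -/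
theorem compositeQtM_letter_of_adm22_T4 (F : T4Family) :
    ∃ (Mh₀ R₀ : ℕ) (q₁ : ℝ), 0 ≤ q₁ ∧
    ∀ (n K : ℕ) (_ : 1 ≤ K - n) (_ : K - n + 1 ≤ F.m + K) {Mh R a' : ℕ} (_ : Mh = F.L ^ a') (_ : Mh₀ ≤ Mh) (_ : R₀ ≤ R)
      (_ : a' + 3 ≤ F.m + n) (D : Domains (F.P K)) (hDk : D.k = K - n) (_ : Adm22 D R (F.L * Mh))
      (w : ℕ → PBond (F.P K) 0 → ℝ) (_ : IsLevWeight (F.P K) (K - n) D w)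
      (hc : ((F.P K).L : ℝ) ^ (K - n) ≠ 0) {aw : BondIdx D → ℝ} (haw : ∀ i, 0 < aw i)
      {𝔸 : Type*} [NormedRing 𝔸] [NormedAlgebra ℂ 𝔸]
      (MV : (BondIdx D → 𝔸) →L[ℂ] (BondIdx D → 𝔸)) (QtV : (BondIdx D → 𝔸) →L[ℂ] (PBond (F.P K) 0 → 𝔸))
      (_ : ∀ (X : BondIdx D → 𝔸) (t : BondIdx D),
        MV X t = ∑ s, ((WithLp.ofLp ((EE D hc haw - aE D aw) (WithLp.toLp 2 (Pi.single s 1))) t : ℝ) : ℂ) • X s)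
      (_ : ∀ (X : BondIdx D → 𝔸) (j : PBond (F.P K) 0),
        QtV X j = (((((((F.P K).L : ℝ))⁻¹) ^ (K - n) : ℝ) : ℂ) ^ (F.P K).d)⁻¹ • ∑ t, ((WithLp.ofLp (QE D (WithLp.toLp 2 (Pi.single j 1))) t : ℝ) : ℂ) • X t)
      (X : BondIdx D → 𝔸) (s : ℝ) (_ : 0 ≤ s) (_ : ∀ t, ‖X t‖ ≤ s) (b : PBond (F.P K) 0),
      w 3 b * ‖QtV (((((((((F.P K).L : ℝ))⁻¹) ^ (K - n) : ℝ) : ℂ) ^ (F.P K).d) • MV) X) b‖ ≤ q₁ * s := by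
  obtain ⟨Mh₀, R₀, q₁, hq₁, hmain⟩ := curlCurlRowSum_of_adm22_T4 F
  refine ⟨Mh₀, R₀, q₁, hq₁, ?_⟩
  intro n K hk1 hk' Mh R a' hMha hMh hR hsize D hDk hAdm w hw hc aw haw 𝔸 _ _ MV QtV hMV hQtV X s hs hX b
  have hrow := hmain n K hk1 hk' hMha hMh hR hsize D hDk hAdm w hw b
  have hw3 : 0 ≤ w 3 b := by rw [hw 3 b]; positivity
  have hL0 : (0 : ℝ) < ((F.P K).L : ℝ) := by exact_mod_cast (F.P K).L_pos
  have hη : ((((F.P K).L : ℝ))⁻¹ ^ (K - n)) ≠ 0 := by positivity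
  -- the real curl-curl row operator of the canonical `H`, and its complex extension `K_V`
  let g : (BondIdx D → ℝ) →ₗ[ℝ] (PBond (F.P K) 0 → ℝ) :=
    (WithLp.linearEquiv 2 ℝ (PBond (F.P K) 0 → ℝ)).toLinearMap ∘ₗ (dcsE (((F.P K).L : ℝ) ^ (K - n)) ∘ₗ dcE (((F.P K).L : ℝ) ^ (K - n))) ∘ₗ
      (WithLp.linearEquiv 2 ℝ (PBond (F.P K) 0 → ℝ)).symm.toLinearMap ∘ₗ flatH (F.P K) (K - n) D
  have hg : ∀ (Y : BondIdx D → ℝ) (b' : PBond (F.P K) 0),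
      g Y b' = (dcsE (((F.P K).L : ℝ) ^ (K - n)) (dcE (((F.P K).L : ℝ) ^ (K - n)) (WithLp.toLp 2 (flatH (F.P K) (K - n) D Y)))) b' := fun _ _ => rfl
  obtain ⟨KV, hKV⟩ := FlatScalarExtension.exists_extension g 𝔸
  have hKV' : ∀ (Y : BondIdx D → 𝔸) (b' : PBond (F.P K) 0), KV Y b' =
      ∑ s', ((WithLp.ofLp (dcsE (((F.P K).L : ℝ) ^ (K - n)) (dcE (((F.P K).L : ℝ) ^ (K - n))
        (hOp (GE D hc haw) (QsE D) (EE D hc haw) (WithLp.toLp 2 (Pi.single s' 1))))) b' : ℝ) : ℂ) • Y s' := by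
    intro Y b'
    rw [hKV]
    exact Finset.sum_congr rfl fun s' _ => by rw [hg, curlCurl_kernel_eq_flatH D hc haw]
  -- the identity `Qᵗ_V((η^d•M_V)X) = K_V X` (p612514), then the row
  have hid : QtV ((((((((F.P K).L : ℝ))⁻¹) ^ (K - n) : ℝ) : ℂ) ^ (F.P K).d) • MV X) b = KV X b :=
    QtV_smul_MV_eq_curlCurlHV D hc haw hη (MV := (MV : (BondIdx D → 𝔸) →ₗ[ℂ] (BondIdx D → 𝔸)))
      (QtV := (QtV : (BondIdx D → 𝔸) →ₗ[ℂ] (PBond (F.P K) 0 → 𝔸))) (KV := KV) hMV hQtV hKV' X b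
  rw [_root_.smul_apply, hid, hKV X b]
  calc w 3 b * ‖∑ s', ((g (Pi.single s' 1) b : ℝ) : ℂ) • X s'‖
      ≤ w 3 b * ((∑ s', |g (Pi.single s' 1) b|) * s) := mul_le_mul_of_nonneg_left (norm_kernel_smul_sum_le (fun s' => g (Pi.single s' 1) b) X hX) hw3
    _ = (w 3 b * ∑ s', |g (Pi.single s' 1) b|) * s := by ring
    _ ≤ q₁ * s := mul_le_mul_of_nonneg_right hrow hs

end Summit.QuantumFields.YangMills.Theorems.K0Stub1CompositeQtMLetterAtRecord

end
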